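import Mathlib.CategoryTheory.ObjectProperty.Equivalence
import Literature.AlgebraicGeometry.Frobenioids.CoproductCompletionResidual
import Literature.AnabelianGeometry.SemiGraphs.BTempCountablyConnectedProofs

/-!
# [SemiAnbd] §3 / [FrdI] §0: an equivalence of CONNECTED PARTS `B^temp(Π₁)⁰ ≌ B^temp(Π₂)⁰` extends to the temperoids

S. Mochizuki, *Semi-graphs of anabelioids*, Publ. RIMS **42** (2006) [MochizukiSemiAnbd2006], §3, Def. 3.1 (ii) p.33:
a connected temperoid `T` is recovered from its connected objects — «`T⁰ ⊆ T`», Rmk. 3.1.5 p.34: every object is a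
countable coproduct of connected objects and `Hom(A, ∐ Bⱼ) = ∐ Hom(A, Bⱼ)` for connected `A`; S. Mochizuki,
*The geometry of Frobenioids I*, Publ. RIMS **44** (2008) [MochizukiFrdI2008], §0 p.16: for a category `E` of countably
connected type the natural functor `(E⁰)^⊤ → E` («form the coproduct») is an equivalence — in the tree
`ConnectedPart.glueCountable_isEquivalence` (abc-iut-L1) with `BTemp.isOfCountablyConnectedType` (abc-iut-L3).

abc-iut cell, seat abc-iut-w5-d013 gen 3 (layer L2, ROW «SUBDAG-EtTh-Thm44 T44-L09 / T44-L09c AT THE TEMPEROID BASE»):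
the EXTENSION datum of `EtaleTheta/Discharge/Sec4Thm44GaloisCompatibleOfEmbeddedBase.lean` for print's base
`D = B^temp(Π^tp_X)⁰` (abc-iut-L2-t4's `mkOfConnectedTemperoid`; the full `B^temp(Π)` is not totally epimorphic,
abc-iut-w4-d099's F-w4d099-1).  CONTENTS:
* `formalCoproductMap F : FormalCoproduct C ⥤ FormalCoproduct D` — functoriality of Mathlib's formal coproducts
  `{Aᵢ} ↦ {F Aᵢ}` in the category `C` (not in Mathlib), with `formalCoproductMapId`, `formalCoproductMapComp`,
  `formalCoproductMapIso`, `inclCompFormalCoproductMapIso` and `formalCoproductMapEquivalence e : C^⊔ ≌ D^⊔`;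
* `countableFormalCoproducts_isClosedUnderIsomorphisms`, `countableCoproductCompletionMapEquivalence e : C^⊤ ≌ D^⊤`
  (restriction to countable index sets, [FrdI] §0's `(−)^⊤`), `toCompletionCompMapIso`;
* `ConnectedPart.singletonFamily`, `ConnectedPart.glueSingletonIso` — gluing a one-member family gives the member
  back: `ι ≅ toCountableCoproductCompletion ⋙ glueCountable`; `formalCoproduct_hom_mk_eq` (bookkeeping);
* **`BTemp.exists_equivalence_extension`** — every equivalence `E⁰ : B^temp(Π₁)⁰ ≌ B^temp(Π₂)⁰` of connected parts
  extends to an equivalence `E : B^temp(Π₁) ≌ B^temp(Π₂)` with `E⁰ ⋙ ι ≅ ι ⋙ E` (`E := glue₂ ∘ (E⁰)^⊤ ∘ glue₁⁻¹`).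
Construction file (functors and natural isomorphisms are definitions; no `Prop`-valued definition, no instance, no
notation); nothing here bears on [IUTchIII] Cor. 3.12.
-/

noncomputable section

open CategoryTheory CategoryTheory.Limits

namespace Literature.AnabelianGeometry.SemiGraphs

universe w v₁ v₂ v₃ u₁ u₂ u₃ u

/-! ### Functoriality of formal coproducts in the category ([FrdI] §0 `C ↦ C^⊥, C^⊤`) -/

section FormalCoproductMap

variable {C : Type u₁} [Category.{v₁} C] {D : Type u₂} [Category.{v₂} D] {E : Type u₃} [Category.{v₃} E]

/-- Two morphisms of formal coproducts with the SAME map of index sets agree as soon as their components agree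
(the dependent-type-friendly form of `FormalCoproduct.hom_ext`; [FrdI] §0 p.16: `Hom(∐ Aᵢ, ∐ Bⱼ) = ∏ᵢ ∐ⱼ Hom(Aᵢ, Bⱼ)`).
[cite: MochizukiFrdI2008, §0 p.16] -/
theorem formalCoproduct_hom_mk_eq {X Y : FormalCoproduct.{w} C} {f : X.I → Y.I}
    {φ ψ : (i : X.I) → (X.obj i ⟶ Y.obj (f i))} (h : ∀ i, φ i = ψ i) :
    (⟨f, φ⟩ : X ⟶ Y) = ⟨f, ψ⟩ := by
  obtain rfl : φ = ψ := funext h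
  rfl

/-- **`{Aᵢ}ᵢ ↦ {F(Aᵢ)}ᵢ`**: a functor `F : C ⥤ D` induces `FormalCoproduct C ⥤ FormalCoproduct D` (same index
sets; componentwise `F`). [cite: MochizukiFrdI2008, §0 p.16] -/
def formalCoproductMap (F : C ⥤ D) : FormalCoproduct.{w} C ⥤ FormalCoproduct.{w} D where
  obj X := ⟨X.I, fun i => F.obj (X.obj i)⟩
  map f := ⟨f.f, fun i => F.map (f.φ i)⟩
  map_id _ := formalCoproduct_hom_mk_eq fun _ => F.map_id _
  map_comp _ _ := formalCoproduct_hom_mk_eq fun _ => F.map_comp _ _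

/-- `formalCoproductMap (𝟭 C) ≅ 𝟭`. [cite: MochizukiFrdI2008, §0 p.16] -/
def formalCoproductMapId : formalCoproductMap.{w} (𝟭 C) ≅ 𝟭 (FormalCoproduct.{w} C) :=
  NatIso.ofComponents (fun X => FormalCoproduct.isoOfComponents (Equiv.refl X.I) fun _ => Iso.refl _)
    fun f => formalCoproduct_hom_mk_eq fun i => by
      change f.φ i ≫ 𝟙 _ = 𝟙 _ ≫ f.φ i
      rw [Category.comp_id, Category.id_comp]

/-- `formalCoproductMap (F ⋙ G) ≅ formalCoproductMap F ⋙ formalCoproductMap G`. [cite: MochizukiFrdI2008, §0 p.16] -/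
def formalCoproductMapComp (F : C ⥤ D) (G : D ⥤ E) :
    formalCoproductMap.{w} (F ⋙ G) ≅ formalCoproductMap.{w} F ⋙ formalCoproductMap.{w} G :=
  NatIso.ofComponents (fun X => FormalCoproduct.isoOfComponents (Equiv.refl X.I) fun _ => Iso.refl _)
    fun f => formalCoproduct_hom_mk_eq fun i => by
      change G.map (F.map (f.φ i)) ≫ 𝟙 _ = 𝟙 _ ≫ G.map (F.map (f.φ i))
      rw [Category.comp_id, Category.id_comp]

/-- A natural isomorphism `F ≅ F'` induces `formalCoproductMap F ≅ formalCoproductMap F'` (componentwise).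
[cite: MochizukiFrdI2008, §0 p.16] -/
def formalCoproductMapIso {F F' : C ⥤ D} (α : F ≅ F') : formalCoproductMap.{w} F ≅ formalCoproductMap.{w} F' :=
  NatIso.ofComponents (fun X => FormalCoproduct.isoOfComponents (Equiv.refl X.I) fun i => α.app (X.obj i))
    fun f => formalCoproduct_hom_mk_eq fun i => by
      change F.map (f.φ i) ≫ α.hom.app _ = α.hom.app _ ≫ F'.map (f.φ i)
      exact α.hom.naturality _

/-- On one-member families `formalCoproductMap F` is `F`: `incl ⋙ formalCoproductMap F ≅ F ⋙ incl`.
[cite: MochizukiFrdI2008, §0 p.16] -/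
def inclCompFormalCoproductMapIso (F : C ⥤ D) :
    FormalCoproduct.incl C ⋙ formalCoproductMap.{w} F ≅ F ⋙ FormalCoproduct.incl D :=
  NatIso.ofComponents (fun _ => FormalCoproduct.isoOfComponents (Equiv.refl _) fun _ => Iso.refl _)
    fun f => formalCoproduct_hom_mk_eq fun i => by
      change F.map f ≫ 𝟙 _ = 𝟙 _ ≫ F.map f
      rw [Category.comp_id, Category.id_comp]

/-- **An equivalence `C ≌ D` induces an equivalence of formal coproducts.** [cite: MochizukiFrdI2008, §0 p.16] -/
def formalCoproductMapEquivalence (e : C ≌ D) : FormalCoproduct.{w} C ≌ FormalCoproduct.{w} D :=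
  CategoryTheory.Equivalence.mk (formalCoproductMap e.functor) (formalCoproductMap e.inverse)
    (formalCoproductMapId.symm ≪≫ formalCoproductMapIso e.unitIso ≪≫ formalCoproductMapComp _ _)
    ((formalCoproductMapComp _ _).symm ≪≫ formalCoproductMapIso e.counitIso ≪≫ formalCoproductMapId)

/-- The functor of `formalCoproductMapEquivalence e` is `formalCoproductMap e.functor` (definitionally).
[cite: MochizukiFrdI2008, §0 p.16] -/
theorem formalCoproductMapEquivalence_functor (e : C ≌ D) :
    (formalCoproductMapEquivalence.{w} e).functor = formalCoproductMap e.functor := rfl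

/-! ### Restriction to countable index sets: `C^⊤ ≌ D^⊤` -/

open Literature.AlgebraicGeometry.Frobenioids

/-- Countability of the index set is invariant under isomorphism of formal coproducts (an isomorphism carries a
bijection of index sets). [cite: MochizukiFrdI2008, §0 p.16] -/
theorem countableFormalCoproducts_isClosedUnderIsomorphisms :
    (countableFormalCoproducts.{w} C).IsClosedUnderIsomorphisms := by
  refine ⟨fun {X Y} e hX => ?_⟩
  change Countable X.I at hX
  change Countable Y.I
  have hid : e.hom.f ∘ e.inv.f = id := congrArg FormalCoproduct.Hom.f e.inv_hom_id
  have hinj : Function.Injective e.inv.f := fun a b h => by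
    have ha := congrFun hid a
    have hb := congrFun hid b
    simp only [Function.comp_apply, id_eq] at ha hb
    rw [← ha, ← hb, h]
  exact hinj.countable

/-- **`(−)^⊤` is functorial in equivalences: `C^⊤ ≌ D^⊤` for `C ≌ D`** (same index sets). [cite: MochizukiFrdI2008, §0 p.16] -/
def countableCoproductCompletionMapEquivalence (e : C ≌ D) :
    CountableCoproductCompletion.{w} C ≌ CountableCoproductCompletion.{w} D :=
  haveI := countableFormalCoproducts_isClosedUnderIsomorphisms.{w} (C := D)
  (formalCoproductMapEquivalence.{w} e).congrFullSubcategory (Q := countableFormalCoproducts.{w} D)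
    (P := countableFormalCoproducts.{w} C) rfl

/-- The functor of `(e)^⊤` on underlying formal coproducts is `formalCoproductMap e.functor` (definitionally).
[cite: MochizukiFrdI2008, §0 p.16] -/
theorem countableCoproductCompletionMapEquivalence_functor_obj (e : C ≌ D) (X : CountableCoproductCompletion.{w} C) :
    ((countableCoproductCompletionMapEquivalence.{w} e).functor.obj X).obj = (formalCoproductMap e.functor).obj X.obj :=
  rfl

/-- On one-member families the induced equivalence of `(−)^⊤` is `e.functor`:
`toCountableCoproductCompletion C ⋙ (e^⊤).functor ≅ e.functor ⋙ toCountableCoproductCompletion D`.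
[cite: MochizukiFrdI2008, §0 p.16] -/
def toCompletionCompMapIso (e : C ≌ D) :
    toCountableCoproductCompletion.{w} C ⋙ (countableCoproductCompletionMapEquivalence.{w} e).functor ≅
      e.functor ⋙ toCountableCoproductCompletion.{w} D :=
  NatIso.ofComponents
    (fun X => (countableFormalCoproducts.{w} D).isoMk
      (FormalCoproduct.isoOfComponents (Equiv.refl PUnit.{w + 1}) fun _ => Iso.refl (e.functor.obj X)))
    fun f => (countableFormalCoproducts.{w} D).ι.map_injective
      ((inclCompFormalCoproductMapIso.{w} e.functor).hom.naturality f)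

end FormalCoproductMap

/-! ### Gluing a one-member family -/

section GlueSingleton

open Literature.AlgebraicGeometry.Frobenioids

variable {E : Type u₁} [Category.{v₁} E] [HasCountableCoproducts E]

/-- The one-member family of `E` glued at `A ∈ E⁰` by `(E⁰)^⊤ → E` (its index type is that of the formal coproduct
`{A}`). [cite: MochizukiFrdI2008, §0 p.16] -/
abbrev ConnectedPart.singletonFamily (A : ConnectedPart E) :
    ((toCountableCoproductCompletion.{w} (ConnectedPart E)).obj A).obj.I → E :=
  fun i => (((toCountableCoproductCompletion.{w} (ConnectedPart E)).obj A).obj.obj i).obj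

/-- **`A ≅ ∐_{* ∈ {*}} A`, naturally**: the inclusion `E⁰ ⊆ E` is the gluing functor `(E⁰)^⊤ → E` restricted along the
singleton embedding `E⁰ → (E⁰)^⊤` (coproduct over a one-point index type). [cite: MochizukiFrdI2008, §0 p.16] -/
def ConnectedPart.glueSingletonIso :
    (connectedObjects E).ι ≅ toCountableCoproductCompletion.{w} (ConnectedPart E) ⋙ ConnectedPart.glueCountable.{w} E :=
  NatIso.ofComponents
    (fun A =>
      haveI : Unique (((toCountableCoproductCompletion.{w} (ConnectedPart E)).obj A).obj.I) :=
        inferInstanceAs (Unique PUnit.{w + 1})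
      (coproductUniqueIso (ConnectedPart.singletonFamily.{w} A)).symm)
    fun {A B} f => by
      haveI : Unique (((toCountableCoproductCompletion.{w} (ConnectedPart E)).obj A).obj.I) :=
        inferInstanceAs (Unique PUnit.{w + 1})
      haveI : Unique (((toCountableCoproductCompletion.{w} (ConnectedPart E)).obj B).obj.I) :=
        inferInstanceAs (Unique PUnit.{w + 1})
      change f.hom ≫ (coproductUniqueIso (ConnectedPart.singletonFamily.{w} B)).inv =
        (coproductUniqueIso (ConnectedPart.singletonFamily.{w} A)).inv ≫
          (ConnectedPart.glueCountable.{w} E).map ((toCountableCoproductCompletion.{w} (ConnectedPart E)).map f)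
      rw [coproductUniqueIso_inv, coproductUniqueIso_inv, ConnectedPart.ι_glue_map]
      rfl

end GlueSingleton

/-! ### The extension theorem for `B^temp(Π)` -/

open Literature.AlgebraicGeometry.Frobenioids

variable {G₁ : Type u} [Group G₁] [TopologicalSpace G₁] [IsTopologicalGroup G₁]
  {G₂ : Type u} [Group G₂] [TopologicalSpace G₂] [IsTopologicalGroup G₂]

/-- **Every equivalence of connected parts `E⁰ : B^temp(Π₁)⁰ ≌ B^temp(Π₂)⁰` extends to the temperoids**: there is an
equivalence `E : B^temp(Π₁) ≌ B^temp(Π₂)` with `E⁰ ⋙ ι ≅ ι ⋙ E` — namely `E := glue₂ ∘ (E⁰)^⊤ ∘ glue₁⁻¹` through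
`(B^temp(Πᵢ)⁰)^⊤ ⥲ B^temp(Πᵢ)` ([FrdI] §0 p.16 for the category of countably connected type `B^temp(Π)`, [SemiAnbd]
Rmk. 3.1.5).  This is the step that lets [SemiAnbd] Prop. 3.2 (stated for functors between the full temperoids) act on
the base categories `D = B^temp(Π^tp_X)⁰` of [EtTh] §3–§5. [cite: MochizukiSemiAnbd2006, Rmk 3.1.5 p.34] -/
theorem BTemp.exists_equivalence_extension (E₀ : ConnectedPart (BTemp G₁) ≌ ConnectedPart (BTemp G₂)) :
    ∃ E : BTemp G₁ ≌ BTemp G₂,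
      Nonempty (E₀.functor ⋙ (connectedObjects (BTemp G₂)).ι ≅ (connectedObjects (BTemp G₁)).ι ⋙ E.functor) := by
  haveI : HasCountableCoproducts (BTemp G₁) := BTemp.hasCountableCoproducts
  haveI : HasCountableCoproducts (BTemp G₂) := BTemp.hasCountableCoproducts
  haveI h₁ := ConnectedPart.glueCountable_isEquivalence.{0} (BTemp.isOfCountablyConnectedType (G := G₁))
  haveI h₂ := ConnectedPart.glueCountable_isEquivalence.{0} (BTemp.isOfCountablyConnectedType (G := G₂))
  -- the gluing equivalences `(B^temp(Πᵢ)⁰)^⊤ ⥲ B^temp(Πᵢ)` and the induced equivalence of completions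
  let Γ₁ := (ConnectedPart.glueCountable.{0} (BTemp G₁)).asEquivalence
  let Γ₂ := (ConnectedPart.glueCountable.{0} (BTemp G₂)).asEquivalence
  let Ehat := countableCoproductCompletionMapEquivalence.{0} E₀
  refine ⟨Γ₁.symm.trans (Ehat.trans Γ₂), ⟨?_⟩⟩
  -- `ι₁ ⋙ glue₁⁻¹ ≅ single₁`
  let j₁ : (connectedObjects (BTemp G₁)).ι ⋙ Γ₁.inverse ≅ toCountableCoproductCompletion.{0} (ConnectedPart (BTemp G₁)) :=
    Functor.isoWhiskerRight (ConnectedPart.glueSingletonIso.{0} (E := BTemp G₁)) Γ₁.inverse ≪≫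
      Functor.isoWhiskerLeft (toCountableCoproductCompletion.{0} (ConnectedPart (BTemp G₁))) Γ₁.unitIso.symm
  -- assemble: `ι₁ ⋙ glue₁⁻¹ ⋙ (E⁰)^⊤ ⋙ glue₂ ≅ single₁ ⋙ (E⁰)^⊤ ⋙ glue₂ ≅ E⁰ ⋙ single₂ ⋙ glue₂ ≅ E⁰ ⋙ ι₂`
  exact (Functor.isoWhiskerRight (Functor.isoWhiskerRight j₁ Ehat.functor ≪≫ toCompletionCompMapIso.{0} E₀) Γ₂.functor ≪≫
    Functor.isoWhiskerLeft E₀.functor (ConnectedPart.glueSingletonIso.{0} (E := BTemp G₂)).symm :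
      (connectedObjects (BTemp G₁)).ι ⋙ (Γ₁.symm.trans (Ehat.trans Γ₂)).functor ≅
        E₀.functor ⋙ (connectedObjects (BTemp G₂)).ι).symm

end Literature.AnabelianGeometry.SemiGraphs

end
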